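import Literature.AnabelianGeometry.SemiGraphs.TemperedPiFullValue
import Literature.AnabelianGeometry.SemiGraphs.CoveringComponentSupport
import Literature.AnabelianGeometry.SemiGraphs.MorphismsOver

/-!
# Fullness of the fibre functor, II: the morphism attached to an equivariant map ([SemiAnbd] Prop. 3.6 (ii))

Sequel to `TemperedPiFullValue.lean`.  For `𝔾` connected, every point of `T` admits admissible
data, and the well-defined transported values assemble to a morphism `fullHom m : T ⟶ T'` of
coverings with `(fullHom m)_{v₀} = m` — every `π₁^temp(𝒢)`-equivariant map of fibres comes from a
morphism of coverings ([SemiAnbd] Prop. 3.6 (ii), p. 38: the functor `B^temp(𝒢) → B^temp(π₁^temp)`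
is full).
-/

namespace Literature.AnabelianGeometry.SemiGraphs

namespace ProfiniteSemiGraph

open CategoryTheory

universe u

variable {𝒢 : ProfiniteSemiGraph.{u}}

namespace GaloisLevelData

variable (D : GaloisLevelData 𝒢) (h𝒢 : 𝒢.IsCountable) (hc : 𝒢.graph.IsConnected) (T T' : CovObj 𝒢)
  (lev : (T.SV D.v₀).obj.V → ℕ)
  (hlev : ∀ (t : (T.SV D.v₀).obj.V) (n : ℕ), lev t ≤ n →
    (D.S n).Splits (T.component (Sum.inl ⟨D.v₀, t⟩)))
  (lev' : (T'.SV D.v₀).obj.V → ℕ)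
  (hlev' : ∀ (t : (T'.SV D.v₀).obj.V) (n : ℕ), lev' t ≤ n →
    (D.S n).Splits (T'.component (Sum.inl ⟨D.v₀, t⟩)))
  (m : D.fibreObj h𝒢 T lev hlev ⟶ D.fibreObj h𝒢 T' lev' hlev')

include hc

/-- Admissible data exist for every vertex point (connectedness of `𝔾`).
[cite: MochizukiSemiAnbd2006, Prop 3.6(ii) p.38] -/
theorem exists_data {v : 𝒢.graph.Vertex} (x : (T.SV v).obj.V) :
    ∃ (x₁ : (T.SV D.v₀).obj.V) (N : ℕ) (h1 : lev x₁ ≤ N) (_ : lev' (m.hom.hom x₁) ≤ N)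
      (u : (D.S N).FibV (Sum.inl (D.W N)) v),
      ((D.liftι h𝒢 T x₁ N (hlev x₁ N h1)).fV v).hom.hom u = x := by
  obtain ⟨x₁, hx₁⟩ := T.exists_mem_component_over hc x D.v₀
  refine ⟨x₁, max (lev x₁) (lev' (m.hom.hom x₁)), le_max_left _ _, le_max_right _ _, ?_⟩
  have h' : T.SameComponent (Sum.inl ⟨D.v₀, ((D.liftι h𝒢 T x₁ _ (hlev x₁ _ (le_max_left (lev x₁)
      (lev' (m.hom.hom x₁))))).fV D.v₀).hom.hom (D.bp _)⟩) (Sum.inl ⟨v, x⟩) := by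
    rw [D.liftι_bp]; exact Relation.EqvGen.symm _ _ hx₁
  exact CovHom.exists_preimage_of_sameComponent
    (D.liftι h𝒢 T x₁ _ (hlev x₁ _ (le_max_left (lev x₁) (lev' (m.hom.hom x₁))))) (D.bp _) x h'

/-- The vertex components of the morphism attached to `m`. [cite: MochizukiSemiAnbd2006, Prop 3.6(ii) p.38] -/
noncomputable def fullV (v : 𝒢.graph.Vertex) (x : (T.SV v).obj.V) : (T'.SV v).obj.V :=
  D.value h𝒢 T T' lev hlev lev' hlev' m (D.exists_data h𝒢 hc T T' lev hlev lev' hlev' m x).choose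
    (D.exists_data h𝒢 hc T T' lev hlev lev' hlev' m x).choose_spec.choose
    (D.exists_data h𝒢 hc T T' lev hlev lev' hlev' m x).choose_spec.choose_spec.choose_spec.choose
    (D.exists_data h𝒢 hc T T' lev hlev lev' hlev' m x).choose_spec.choose_spec.choose_spec.choose_spec.choose

/-- `fullV` is computed by ANY admissible data. [cite: MochizukiSemiAnbd2006, Prop 3.6(ii) p.38] -/
theorem fullV_eq {v : 𝒢.graph.Vertex} (x : (T.SV v).obj.V) (x₁ : (T.SV D.v₀).obj.V) (N : ℕ)
    (h1 : lev x₁ ≤ N) (h2 : lev' (m.hom.hom x₁) ≤ N) (u : (D.S N).FibV (Sum.inl (D.W N)) v)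
    (hu : ((D.liftι h𝒢 T x₁ N (hlev x₁ N h1)).fV v).hom.hom u = x) :
    D.fullV h𝒢 hc T T' lev hlev lev' hlev' m v x = D.value h𝒢 T T' lev hlev lev' hlev' m x₁ N h2 u :=
  D.value_indep h𝒢 T T' lev hlev lev' hlev' m x _ _
    (D.exists_data h𝒢 hc T T' lev hlev lev' hlev' m x).choose_spec.choose_spec.choose
    (D.exists_data h𝒢 hc T T' lev hlev lev' hlev' m x).choose_spec.choose_spec.choose_spec.choose _
    (D.exists_data h𝒢 hc T T' lev hlev lev' hlev' m x).choose_spec.choose_spec.choose_spec.choose_spec.choose_spec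
    x₁ N h1 h2 u hu

/-- On the base fibre, `fullV = m`. [cite: MochizukiSemiAnbd2006, Prop 3.6(ii) p.38] -/
theorem fullV_base (x : (T.SV D.v₀).obj.V) : D.fullV h𝒢 hc T T' lev hlev lev' hlev' m D.v₀ x = m.hom.hom x := by
  rw [D.fullV_eq h𝒢 hc T T' lev hlev lev' hlev' m x x (max (lev x) (lev' (m.hom.hom x))) (le_max_left _ _)
    (le_max_right _ _) (D.bp _) (D.liftι_bp h𝒢 T x _ _)]
  exact D.liftι_bp h𝒢 T' _ _ _

/-- `fullV` is `Π_v`-equivariant. [cite: MochizukiSemiAnbd2006, Prop 3.6(ii) p.38] -/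
theorem fullV_ρ (v : 𝒢.graph.Vertex) (g : 𝒢.Gv v) (x : (T.SV v).obj.V) :
    D.fullV h𝒢 hc T T' lev hlev lev' hlev' m v ((T.SV v).obj.ρ g x) =
      (T'.SV v).obj.ρ g (D.fullV h𝒢 hc T T' lev hlev lev' hlev' m v x) := by
  obtain ⟨x₁, N, h1, h2, u, hu⟩ := D.exists_data h𝒢 hc T T' lev hlev lev' hlev' m x
  rw [D.fullV_eq h𝒢 hc T T' lev hlev lev' hlev' m x x₁ N h1 h2 u hu,
    D.fullV_eq h𝒢 hc T T' lev hlev lev' hlev' m _ x₁ N h1 h2 (((D.cover h𝒢 N).SV v).obj.ρ g u)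
      ((CovHom.fV_ρ (D.liftι h𝒢 T x₁ N (hlev x₁ N h1)) v g u).trans
        (congrArg (fun z => (T.SV v).obj.ρ g z) hu))]
  exact CovHom.fV_ρ (D.liftι h𝒢 T' (m.hom.hom x₁) N (hlev' _ N h2)) v g u

/-- Admissible EDGE data exist for every edge point (every edge abuts to a vertex, `𝔾` being
connected with a vertex). [cite: MochizukiSemiAnbd2006, Prop 3.6(ii) p.38] -/
theorem exists_edge_data {e : 𝒢.graph.Edge} (y : (T.SE e).obj.V) :
    ∃ (x₁ : (T.SV D.v₀).obj.V) (N : ℕ) (h1 : lev x₁ ≤ N) (_ : lev' (m.hom.hom x₁) ≤ N)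
      (w : (D.S N).FibE (Sum.inl (D.W N)) e),
      ((D.liftι h𝒢 T x₁ N (hlev x₁ N h1)).fE e).hom.hom w = y := by
  obtain ⟨b, hbe, hb⟩ := SemiGraph.exists_abuts_of_isConnected hc D.v₀ e
  obtain ⟨v, hv⟩ := Option.isSome_iff_exists.mp hb
  subst hbe
  obtain ⟨x₁, N, h1, h2, u, hu⟩ :=
    D.exists_data h𝒢 hc T T' lev hlev lev' hlev' m ((T.glue b v hv).hom.hom.hom y)
  refine ⟨x₁, N, h1, h2, (D.S N).glueOverInv _ b v hv u, ?_⟩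
  apply Function.LeftInverse.injective (T.glue_inv_hom b v hv)
  refine (CovHom.glue_fE (D.liftι h𝒢 T x₁ N (hlev x₁ N h1)) b v hv _).trans ?_
  change ((D.liftι h𝒢 T x₁ N (hlev x₁ N h1)).fV v).hom.hom
    ((D.S N).glueOverFun _ b v hv ((D.S N).glueOverInv _ b v hv u)) = _
  rw [CovObj.glueOverFun_glueOverInv, hu]

omit hc in
/-- The candidate edge value. [cite: MochizukiSemiAnbd2006, Prop 3.6(ii) p.38] -/
noncomputable def valueE (x₁ : (T.SV D.v₀).obj.V) (N : ℕ) (h2 : lev' (m.hom.hom x₁) ≤ N)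
    {e : 𝒢.graph.Edge} (w : (D.S N).FibE (Sum.inl (D.W N)) e) : (T'.SE e).obj.V :=
  ((D.liftι h𝒢 T' (m.hom.hom x₁) N (hlev' _ N h2)).fE e).hom.hom w

omit hc in
/-- Edge values glue to vertex values. [cite: MochizukiSemiAnbd2006, Prop 3.6(ii) p.38] -/
theorem glue_valueE (x₁ : (T.SV D.v₀).obj.V) (N : ℕ) (h2 : lev' (m.hom.hom x₁) ≤ N)
    (b : 𝒢.graph.Branch) (v : 𝒢.graph.Vertex) (hv : 𝒢.graph.abuts b = some v)
    (w : (D.S N).FibE (Sum.inl (D.W N)) (𝒢.graph.edgeOf b)) :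
    (T'.glue b v hv).hom.hom.hom (D.valueE h𝒢 T T' lev hlev lev' hlev' m x₁ N h2 w) =
      D.value h𝒢 T T' lev hlev lev' hlev' m x₁ N h2 ((D.S N).glueOverFun _ b v hv w) :=
  CovHom.glue_fE (D.liftι h𝒢 T' (m.hom.hom x₁) N (hlev' _ N h2)) b v hv w

/-- The edge components of the morphism attached to `m`. [cite: MochizukiSemiAnbd2006, Prop 3.6(ii) p.38] -/
noncomputable def fullE (e : 𝒢.graph.Edge) (y : (T.SE e).obj.V) : (T'.SE e).obj.V :=
  D.valueE h𝒢 T T' lev hlev lev' hlev' m (D.exists_edge_data h𝒢 hc T T' lev hlev lev' hlev' m y).choose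
    (D.exists_edge_data h𝒢 hc T T' lev hlev lev' hlev' m y).choose_spec.choose
    (D.exists_edge_data h𝒢 hc T T' lev hlev lev' hlev' m y).choose_spec.choose_spec.choose_spec.choose
    (D.exists_edge_data h𝒢 hc T T' lev hlev lev' hlev' m y).choose_spec.choose_spec.choose_spec.choose_spec.choose

/-- `fullE` is computed by ANY admissible edge data. [cite: MochizukiSemiAnbd2006, Prop 3.6(ii) p.38] -/
theorem fullE_eq {e : 𝒢.graph.Edge} (y : (T.SE e).obj.V) (x₁ : (T.SV D.v₀).obj.V) (N : ℕ)
    (h1 : lev x₁ ≤ N) (h2 : lev' (m.hom.hom x₁) ≤ N) (w : (D.S N).FibE (Sum.inl (D.W N)) e)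
    (hw : ((D.liftι h𝒢 T x₁ N (hlev x₁ N h1)).fE e).hom.hom w = y) :
    D.fullE h𝒢 hc T T' lev hlev lev' hlev' m e y = D.valueE h𝒢 T T' lev hlev lev' hlev' m x₁ N h2 w := by
  -- the chosen data
  have hw₀ := (D.exists_edge_data h𝒢 hc T T' lev hlev lev' hlev' m y).choose_spec.choose_spec.choose_spec.choose_spec.choose_spec
  -- glue at an abutting branch and use the vertex independence
  obtain ⟨b, hbe, hb⟩ := SemiGraph.exists_abuts_of_isConnected hc D.v₀ e
  obtain ⟨v, hv⟩ := Option.isSome_iff_exists.mp hb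
  subst hbe
  apply Function.LeftInverse.injective (T'.glue_inv_hom b v hv)
  change (T'.glue b v hv).hom.hom.hom (D.valueE h𝒢 T T' lev hlev lev' hlev' m _ _ _ _) =
    (T'.glue b v hv).hom.hom.hom _
  rw [D.glue_valueE, D.glue_valueE]
  have e₁ := D.fullV_eq h𝒢 hc T T' lev hlev lev' hlev' m ((T.glue b v hv).hom.hom.hom y)
    (D.exists_edge_data h𝒢 hc T T' lev hlev lev' hlev' m y).choose
    (D.exists_edge_data h𝒢 hc T T' lev hlev lev' hlev' m y).choose_spec.choose
    (D.exists_edge_data h𝒢 hc T T' lev hlev lev' hlev' m y).choose_spec.choose_spec.choose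
    (D.exists_edge_data h𝒢 hc T T' lev hlev lev' hlev' m y).choose_spec.choose_spec.choose_spec.choose
    ((D.S _).glueOverFun _ b v hv
      (D.exists_edge_data h𝒢 hc T T' lev hlev lev' hlev' m y).choose_spec.choose_spec.choose_spec.choose_spec.choose)
    ((CovHom.glue_fE (D.liftι h𝒢 T _ _ (hlev _ _
      (D.exists_edge_data h𝒢 hc T T' lev hlev lev' hlev' m y).choose_spec.choose_spec.choose)) b v hv _).symm.trans
      (congrArg (fun z => (T.glue b v hv).hom.hom.hom z) hw₀))
  have e₂ := D.fullV_eq h𝒢 hc T T' lev hlev lev' hlev' m ((T.glue b v hv).hom.hom.hom y) x₁ N h1 h2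
    ((D.S N).glueOverFun _ b v hv w)
    ((CovHom.glue_fE (D.liftι h𝒢 T x₁ N (hlev x₁ N h1)) b v hv w).symm.trans
      (congrArg (fun z => (T.glue b v hv).hom.hom.hom z) hw))
  rw [← e₁, ← e₂]

/-- `fullE` is `Π_e`-equivariant. [cite: MochizukiSemiAnbd2006, Prop 3.6(ii) p.38] -/
theorem fullE_ρ (e : 𝒢.graph.Edge) (g : 𝒢.Ge e) (y : (T.SE e).obj.V) :
    D.fullE h𝒢 hc T T' lev hlev lev' hlev' m e ((T.SE e).obj.ρ g y) =
      (T'.SE e).obj.ρ g (D.fullE h𝒢 hc T T' lev hlev lev' hlev' m e y) := by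
  obtain ⟨x₁, N, h1, h2, w, hw⟩ := D.exists_edge_data h𝒢 hc T T' lev hlev lev' hlev' m y
  rw [D.fullE_eq h𝒢 hc T T' lev hlev lev' hlev' m y x₁ N h1 h2 w hw,
    D.fullE_eq h𝒢 hc T T' lev hlev lev' hlev' m _ x₁ N h1 h2 (((D.cover h𝒢 N).SE e).obj.ρ g w)
      ((CovHom.fE_ρ (D.liftι h𝒢 T x₁ N (hlev x₁ N h1)) e g w).trans
        (congrArg (fun z => (T.SE e).obj.ρ g z) hw))]
  exact CovHom.fE_ρ (D.liftι h𝒢 T' (m.hom.hom x₁) N (hlev' _ N h2)) e g w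

/-- **The morphism of coverings attached to a `π₁^temp`-equivariant map of fibres.**
[cite: MochizukiSemiAnbd2006, Prop 3.6(ii) p.38] -/
noncomputable def fullHom : T ⟶ T' where
  fV v := ObjectProperty.homMk
    { hom := TypeCat.ofHom (D.fullV h𝒢 hc T T' lev hlev lev' hlev' m v)
      comm := fun g => by
        apply ConcreteCategory.hom_ext
        intro x
        exact D.fullV_ρ h𝒢 hc T T' lev hlev lev' hlev' m v g x }
  fE e := ObjectProperty.homMk
    { hom := TypeCat.ofHom (D.fullE h𝒢 hc T T' lev hlev lev' hlev' m e)
      comm := fun g => by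
        apply ConcreteCategory.hom_ext
        intro y
        exact D.fullE_ρ h𝒢 hc T T' lev hlev lev' hlev' m e g y }
  comm b v hv := by
    apply ObjectProperty.hom_ext
    apply Action.Hom.ext
    apply ConcreteCategory.hom_ext
    intro y
    obtain ⟨x₁, N, h1, h2, w, hw⟩ := D.exists_edge_data h𝒢 hc T T' lev hlev lev' hlev' m y
    change (T'.glue b v hv).hom.hom.hom (D.fullE h𝒢 hc T T' lev hlev lev' hlev' m _ y) =
      D.fullV h𝒢 hc T T' lev hlev lev' hlev' m v ((T.glue b v hv).hom.hom.hom y)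
    rw [D.fullE_eq h𝒢 hc T T' lev hlev lev' hlev' m y x₁ N h1 h2 w hw, D.glue_valueE,
      D.fullV_eq h𝒢 hc T T' lev hlev lev' hlev' m _ x₁ N h1 h2 ((D.S N).glueOverFun _ b v hv w)
        ((CovHom.glue_fE (D.liftι h𝒢 T x₁ N (hlev x₁ N h1)) b v hv w).symm.trans
          (congrArg (fun z => (T.glue b v hv).hom.hom.hom z) hw))]

/-- **`(fullHom m)_{v₀} = m`.** [cite: MochizukiSemiAnbd2006, Prop 3.6(ii) p.38] -/
theorem fullHom_base (x : (T.SV D.v₀).obj.V) :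
    ((D.fullHom h𝒢 hc T T' lev hlev lev' hlev' m).fV D.v₀).hom.hom x = m.hom.hom x :=
  D.fullV_base h𝒢 hc T T' lev hlev lev' hlev' m x

end GaloisLevelData

end ProfiniteSemiGraph

end Literature.AnabelianGeometry.SemiGraphs
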